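import Summits.CriticalPhenomena.PercolationContinuityZ3.Theorems.PercNearOneGluingNoHeavyQuantFarCycleBlockUnits
import Summits.CriticalPhenomena.PercolationContinuityZ3.Theorems.PercNearOneGluingNoHeavyQuantFarDecLawBounds
import HarnessLib

/-!
# QUANT lane R8, front "FAR beyond trees", layer one — PENDANT CYCLE BLOCKS IV: THE BLOCK NUMBERS ARE `omH` AND `TT`
# (partition by the extent of the counter-clockwise arm; `P_w(X = 0) = omH n C`, `P_w(X ≥ 2) = TT n C`)

builds on p205010 (kernel theorem, internal audit signed; external expert review pending)

Support file (`--supports stmt-CriticalPhenomena-4575`), seat `prim-quant-p1` (gen 22); memo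
`run/shared/lean/prim/quant/prim-quant-p1-g22/FOR-LEAD-KHUB.md` §3.  Standard axioms; no sorries.

Setting of `…QuantFarCycleBlockChain/Units`: a pendant cycle block, a strictly increasing list `ps` of positions in `[1, L)`, `C = chainOf … 0 ps`,
`n = |ps|`, `P_i = lpos L 0 ps i` (`P_0 = 0`, `P_{n+1} = L`).  The ARC COUNT over the list is
`Block.arcCountL … ps ω = Σ_{p ∈ ps} 𝟙[RC ω p]·W_p(ω)`.  Partition the configurations by the number `f ∈ [0, n]` of listed hubs NOT covered by the
counter-clockwise arm: `Block.Dext … ps f = {CCW P_{f+1} ∧ (f = 0 ∨ ¬ CCW P_f)}` (`Block.real_eq_sum_Dext`; `P_w(Dext f) = B_{f+1} − B_f`, `= B_1` for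
`f = 0`).  On `Dext f` the covered hubs `f+1, …, n` are reached and the free hubs `1, …, f` are reached exactly by the clockwise arm, so
`arcCountL ps = coll (ps.take f) + units (ps.drop f)` (`Block.arcCountL_eq_on_Dext`); the three factors are independent (disjoint edge sets), whence
with `…QuantFarCycleBlockUnits`:
* **`Block.real_arcCountL_eq_zero`** — `P_w(arcCountL ps = 0) = omH n C`;  **`Block.real_arcCountL_ge_two`** — `P_w(arcCountL ps ≥ 2) = TT n C`.
Finally `Block.arcCount_eq_arcCountL`: the block's arc count (`…QuantFarCycleBlockReach`) is the arc count over the list `Block.loadedList` of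
LOADED positions (a hub with no relay counts nothing).  [cite: Grimmett1999, §1.3 p. 10; §2.2]; bookkeeping [this work].
-/

noncomputable section

namespace Summit.CriticalPhenomena.PercolationContinuityZ3.Theorems

namespace Quant

namespace Block

open Finset MeasureTheory Set
open Literature.Probability.LatticeModels
open Literature.Probability.Percolation
open Summit.CriticalPhenomena.PercolationContinuityZ3.Theorems.HairyCycle (cycE CW CCW RC)
open TwoChain (ZF SF ZQ SQ g1 g2 PE PS DN GZ GS omH TT)
open scoped Classical

variable {n : ℕ}

/-! ## The arc count over a list of positions -/

/-- `Σ_{p ∈ qs} 𝟙[RC ω p]·W_p(ω)`. [this work] -/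
def arcCountL (L : ℕ) (cyc : ℕ → Fin n) (S : ℕ → Finset (Fin n)) (A : Finset (Fin n)) (qs : List ℕ) (ω : BondConfig (Fin n)) : ℕ :=
  (qs.map fun p => if RC L cyc ω p then hubCount cyc S A p ω else 0).sum

/-- The event "exactly `f` listed hubs are free of the counter-clockwise arm". [this work] -/
def Dext (L : ℕ) (cyc : ℕ → Fin n) (ps : List ℕ) (f : ℕ) : Set (BondConfig (Fin n)) :=
  {ω | CCW L cyc ω (lpos L 0 ps (f + 1)) ∧ (f = 0 ∨ ¬ CCW L cyc ω (lpos L 0 ps f))}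

section Defs

variable (L : ℕ) (cyc : ℕ → Fin n) (S : ℕ → Finset (Fin n)) (A : Finset (Fin n))

/-- [this work] -/ @[simp] theorem arcCountL_cons (p : ℕ) (qs : List ℕ) (ω : BondConfig (Fin n)) :
    arcCountL L cyc S A (p :: qs) ω = (if RC L cyc ω p then hubCount cyc S A p ω else 0) + arcCountL L cyc S A qs ω := by simp [arcCountL]
/-- [this work] -/ theorem arcCountL_append (qs qs' : List ℕ) (ω : BondConfig (Fin n)) :
    arcCountL L cyc S A (qs ++ qs') ω = arcCountL L cyc S A qs ω + arcCountL L cyc S A qs' ω := by simp [arcCountL]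
/-- If no listed position is reached counter-clockwise, the arc count is the clockwise collection. [this work] -/
theorem arcCountL_eq_coll {qs : List ℕ} {ω : BondConfig (Fin n)} (h : ∀ q ∈ qs, ¬ CCW L cyc ω q) :
    arcCountL L cyc S A qs ω = coll L cyc S A qs ω := by
  induction qs with
  | nil => rfl
  | cons q qs ih =>
    rw [arcCountL_cons, coll_cons, ih fun q' hq' => h q' (by simp [hq'])]
    have : RC L cyc ω q ↔ CW L cyc ω q := ⟨fun hr => hr.elim id fun hc => absurd hc (h q (by simp)), Or.inl⟩
    simp only [this]

/-- If every listed position is reached counter-clockwise, the arc count is the unit count. [this work] -/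
theorem arcCountL_eq_units {qs : List ℕ} {ω : BondConfig (Fin n)} (h : ∀ q ∈ qs, CCW L cyc ω q) :
    arcCountL L cyc S A qs ω = units cyc S A qs ω := by
  induction qs with
  | nil => rfl
  | cons q qs ih =>
    have hq : RC L cyc ω q := Or.inr (h q (by simp))
    rw [arcCountL_cons, units_cons, ih fun q' hq' => h q' (by simp [hq']), if_pos hq]

end Defs

section Laws

variable {L : ℕ} {cyc : ℕ → Fin n} {S : ℕ → Finset (Fin n)} {Z : Finset (Fin n)} (H : IsCycleBlock L cyc S Z)
  (A : Finset (Fin n)) (w : Sym2 (Fin n) → unitInterval)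
  {ps : List ℕ} (hps : ∀ p ∈ ps, 1 ≤ p ∧ p < L) (hsort : ps.Pairwise (· < ·))

/-- The position function of a strictly increasing list in `[1, L)` is monotone. [this work] -/
theorem lpos_monotone (hps : ∀ p ∈ ps, 1 ≤ p ∧ p < L) (hsort : ps.Pairwise (· < ·)) : Monotone (lpos L 0 ps) :=
  monotone_nat_of_le_succ fun i => lpos_mono hsort (fun p _ => Nat.zero_le p) (fun p hp => (hps p hp).2.le) (Nat.zero_le L) i

include hps hsort in
/-- Elements of `ps.take f` lie at positions `≤ P_f`. [this work] -/
theorem le_lpos_of_mem_take {f q : ℕ} (hq : q ∈ ps.take f) : q ≤ lpos L 0 ps f := by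
  obtain ⟨i, hi, hiq⟩ := List.getElem_of_mem hq
  rw [List.length_take] at hi
  have hi' : i < ps.length := lt_of_lt_of_le hi (min_le_right _ _)
  have hif : i < f := lt_of_lt_of_le hi (min_le_left _ _)
  rw [List.getElem_take] at hiq
  rw [← hiq, ← lpos_of_lt_length (L := L) (pre := 0) hi']
  exact lpos_monotone hps hsort (by omega)

include hps hsort in
/-- Elements of `ps.drop f` lie at positions `≥ P_{f+1}`. [this work] -/
theorem lpos_le_of_mem_drop {f q : ℕ} (hq : q ∈ ps.drop f) : lpos L 0 ps (f + 1) ≤ q := by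
  obtain ⟨i, hi, hiq⟩ := List.getElem_of_mem hq
  rw [List.length_drop] at hi
  rw [List.getElem_drop] at hiq
  rw [← hiq, ← lpos_of_lt_length (L := L) (pre := 0) (by omega)]
  exact lpos_monotone hps hsort (by omega)

include hps hsort in
/-- **On `Dext f` the arc count splits**: the free hubs are reached exactly by the clockwise arm, the covered ones are reached. [this work] -/
theorem arcCountL_eq_on_Dext {f : ℕ} {ω : BondConfig (Fin n)} (hω : ω ∈ Dext L cyc ps f) :
    arcCountL L cyc S A ps ω = coll L cyc S A (ps.take f) ω + units cyc S A (ps.drop f) ω := by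
  obtain ⟨hcov, hfree⟩ := hω
  conv_lhs => rw [← List.take_append_drop f ps]
  rw [arcCountL_append, arcCountL_eq_coll L cyc S A, arcCountL_eq_units L cyc S A]
  · intro q hq
    exact CCW_mono (lpos_le_of_mem_drop hps hsort hq) hcov
  · intro q hq hc
    rcases hfree with rfl | hfree
    · simp at hq
    · exact hfree (CCW_mono (le_lpos_of_mem_take hps hsort hq) hc)

include hps hsort in
/-- The events `Dext f`, `f ≤ |ps|`, are pairwise disjoint. [this work] -/
theorem pairwiseDisjoint_Dext : (↑(Finset.range (ps.length + 1)) : Set ℕ).PairwiseDisjoint (Dext L cyc ps) := by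
  intro f _ f' _ hff'
  rw [Function.onFun, Set.disjoint_left]
  rintro ω ⟨h1, h2⟩ ⟨h1', h2'⟩
  rcases lt_or_gt_of_ne hff' with h | h
  · rcases h2' with rfl | h2'
    · omega
    · exact h2' (CCW_mono (lpos_monotone hps hsort (by omega)) h1)
  · rcases h2 with rfl | h2
    · omega
    · exact h2 (CCW_mono (lpos_monotone hps hsort (by omega)) h1')

/-- The events `Dext f`, `f ≤ |ps|`, cover everything. [this work] -/
theorem exists_mem_Dext (ω : BondConfig (Fin n)) : ∃ f ∈ Finset.range (ps.length + 1), ω ∈ Dext L cyc ps f := by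
  have hex : ∃ f, CCW L cyc ω (lpos L 0 ps (f + 1)) :=
    ⟨ps.length, by rw [lpos_of_length_lt (by omega)]; exact CCW_top L cyc ω⟩
  refine ⟨Nat.find hex, Finset.mem_range.2 ?_, Nat.find_spec hex, ?_⟩
  · have := Nat.find_min' hex (show CCW L cyc ω (lpos L 0 ps (ps.length + 1)) by rw [lpos_of_length_lt (by omega)]; exact CCW_top L cyc ω)
    omega
  · by_cases h0 : Nat.find hex = 0
    · exact Or.inl h0
    · right
      obtain ⟨k, hk⟩ : ∃ k, Nat.find hex = k + 1 := ⟨Nat.find hex - 1, by omega⟩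
      have hmin := Nat.find_min hex (show k < Nat.find hex by omega)
      rw [hk]; exact hmin

include hps in
/-- **Partition formula**: `P_w(E) = Σ_{f ≤ |ps|} P_w(E ∩ Dext f)`. [this work] -/
theorem real_eq_sum_Dext (hsort : ps.Pairwise (· < ·)) (E : Set (BondConfig (Fin n))) :
    (prodBernoulli w).real E = ∑ f ∈ Finset.range (ps.length + 1), (prodBernoulli w).real (E ∩ Dext L cyc ps f) := by
  have hmeas : ∀ U : Set (BondConfig (Fin n)), MeasurableSet U := fun U => (Set.toFinite U).measurableSet
  have hE : E = ⋃ f ∈ Finset.range (ps.length + 1), (E ∩ Dext L cyc ps f) := by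
    ext ω
    simp only [Set.mem_iUnion, Set.mem_inter_iff, exists_and_left, exists_prop]
    constructor
    · intro hω
      obtain ⟨f, hf, hD⟩ := exists_mem_Dext (L := L) (cyc := cyc) (ps := ps) ω
      exact ⟨hω, f, hf, hD⟩
    · rintro ⟨hω, -⟩; exact hω
  conv_lhs => rw [hE]
  refine measureReal_biUnion_finset (fun f hf f' hf' hff' => ?_) (fun f _ => hmeas _)
  exact Disjoint.mono Set.inter_subset_right Set.inter_subset_right (pairwiseDisjoint_Dext hps hsort hf hf' hff')

include H hps hsort in
/-- **`P_w(Dext f) = B_{f+1} − B_f`** (`1 ≤ f`), with `B = (chainOf … 0 ps).B`. [this work] -/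
theorem real_Dext_succ (f : ℕ) :
    (prodBernoulli w).real (Dext L cyc ps (f + 1)) =
      (chainOf L cyc S A w 0 ps).B (f + 1 + 1) - (chainOf L cyc S A w 0 ps).B (f + 1) := by
  have hmeas : ∀ U : Set (BondConfig (Fin n)), MeasurableSet U := fun U => (Set.toFinite U).measurableSet
  have e : Dext L cyc ps (f + 1) = {ω | CCW L cyc ω (lpos L 0 ps (f + 1 + 1))} \ {ω | CCW L cyc ω (lpos L 0 ps (f + 1))} := by
    ext ω
    constructor
    · rintro ⟨h1, h2⟩; exact ⟨h1, h2.resolve_left (Nat.succ_ne_zero f)⟩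
    · rintro ⟨h1, h2⟩; exact ⟨h1, Or.inr h2⟩
  have hsub : {ω : BondConfig (Fin n) | CCW L cyc ω (lpos L 0 ps (f + 1))} ⊆ {ω | CCW L cyc ω (lpos L 0 ps (f + 1 + 1))} :=
    fun ω hω => CCW_mono (lpos_monotone hps hsort (by omega)) hω
  have hint : {ω : BondConfig (Fin n) | CCW L cyc ω (lpos L 0 ps (f + 1 + 1))} ∩ {ω | CCW L cyc ω (lpos L 0 ps (f + 1))} =
      {ω | CCW L cyc ω (lpos L 0 ps (f + 1))} := Set.inter_eq_right.2 hsub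
  have h := measureReal_inter_add_sdiff (μ := prodBernoulli w) (s := {ω : BondConfig (Fin n) | CCW L cyc ω (lpos L 0 ps (f + 1 + 1))})
    (hmeas {ω | CCW L cyc ω (lpos L 0 ps (f + 1))})
  rw [hint, real_CCW w H, real_CCW w H] at h
  rw [e]
  show _ = ccwProb L cyc w (lpos L 0 ps (f + 1 + 1)) - ccwProb L cyc w (lpos L 0 ps (f + 1))
  linarith

include H in
/-- **`P_w(Dext 0) = B_1`**. [this work] -/
theorem real_Dext_zero : (prodBernoulli w).real (Dext L cyc ps 0) = (chainOf L cyc S A w 0 ps).B 1 := by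
  rw [show Dext L cyc ps 0 = {ω | CCW L cyc ω (lpos L 0 ps 1)} by ext ω; simp only [Dext, mem_setOf_eq, true_or, and_true], real_CCW w H]
  rfl

/-- `Dext f` is read off the counter-clockwise edges from `P_f`. [this work] -/
theorem readsOff_Dext (hps : ∀ p ∈ ps, 1 ≤ p ∧ p < L) (hsort : ps.Pairwise (· < ·)) (f : ℕ) :
    DeterminedBy (Dext L cyc ps f) (↑(ccwEdges L cyc (lpos L 0 ps f)) : Set (Sym2 (Fin n))) := by
  have hsub : ccwEdges L cyc (lpos L 0 ps (f + 1)) ⊆ ccwEdges L cyc (lpos L 0 ps f) :=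
    Finset.image_subset_image (Finset.Ico_subset_Ico_left (lpos_monotone hps hsort (Nat.le_succ f)))
  have h := ((readsOff_CCW L cyc (lpos L 0 ps (f + 1))).mono (Finset.coe_subset.2 hsub)).map₂ (readsOff_CCW L cyc (lpos L 0 ps f))
    fun (a b : Prop) => a ∧ (f = 0 ∨ ¬ b)
  rw [Set.union_self] at h
  exact h.determinedBy id

include H hps hsort in
/-- **Independence on the partition**: for events `U` read off `units (ps.drop f)` and `V` read off `coll (ps.take f)`,
`P_w(Dext f ∩ (V ∩ U)) = P_w(Dext f)·P_w(V)·P_w(U)`. [this work] -/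
theorem real_Dext_inter (f : ℕ) (P Q : ℕ → Prop) :
    (prodBernoulli w).real (Dext L cyc ps f ∩ ({ω | P (coll L cyc S A (ps.take f) ω)} ∩ {ω | Q (units cyc S A (ps.drop f) ω)})) =
      (prodBernoulli w).real (Dext L cyc ps f) * (prodBernoulli w).real {ω | P (coll L cyc S A (ps.take f) ω)} *
        (prodBernoulli w).real {ω | Q (units cyc S A (ps.drop f) ω)} := by
  have hmeas : ∀ U : Set (BondConfig (Fin n)), MeasurableSet U := fun U => (Set.toFinite U).measurableSet
  have hPf : lpos L 0 ps f ≤ L := lpos_le (fun p hp => (hps p hp).2.le) (Nat.zero_le L) f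
  have htk : ∀ q ∈ ps.take f, 1 ≤ q ∧ q < L := fun q hq => hps q (List.mem_of_mem_take hq)
  have hdp : ∀ q ∈ ps.drop f, 1 ≤ q ∧ q < L := fun q hq => hps q (List.mem_of_mem_drop hq)
  have hnd : ps.Nodup := hsort.imp ne_of_lt
  -- determining sets
  have dD := readsOff_Dext (cyc := cyc) hps hsort f
  have dV : DeterminedBy {ω | P (coll L cyc S A (ps.take f) ω)} (↑(cwEdges L cyc (lpos L 0 ps f) ∪ hubPairsL cyc S (ps.take f)) : Set (Sym2 (Fin n))) := by
    have h := (readsOff_coll L cyc S A (qs := ps.take f) (P := lpos L 0 ps f) (fun q hq => le_lpos_of_mem_take hps hsort hq)).determinedBy P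
    rw [Finset.coe_union]; exact h
  have dU : DeterminedBy {ω | Q (units cyc S A (ps.drop f) ω)} (↑(hubPairsL cyc S (ps.drop f)) : Set (Sym2 (Fin n))) :=
    (readsOff_units cyc S A (ps.drop f)).determinedBy Q
  have dVU : DeterminedBy ({ω | P (coll L cyc S A (ps.take f) ω)} ∩ {ω | Q (units cyc S A (ps.drop f) ω)})
      (↑((cwEdges L cyc (lpos L 0 ps f) ∪ hubPairsL cyc S (ps.take f)) ∪ hubPairsL cyc S (ps.drop f)) : Set (Sym2 (Fin n))) := by
    rw [Finset.coe_union]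
    exact (dV.mono Set.subset_union_left).inter (dU.mono Set.subset_union_right)
  -- disjointness
  have hd1 : Disjoint (ccwEdges L cyc (lpos L 0 ps f)) ((cwEdges L cyc (lpos L 0 ps f) ∪ hubPairsL cyc S (ps.take f)) ∪ hubPairsL cyc S (ps.drop f)) := by
    rw [Finset.disjoint_union_right, Finset.disjoint_union_right]
    exact ⟨⟨(disjoint_cw_ccw H hPf).symm, disjoint_ccwEdges_hubPairsL H _ htk⟩, disjoint_ccwEdges_hubPairsL H _ hdp⟩
  have hd2 : Disjoint (cwEdges L cyc (lpos L 0 ps f) ∪ hubPairsL cyc S (ps.take f)) (hubPairsL cyc S (ps.drop f)) := by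
    rw [Finset.disjoint_union_left]
    refine ⟨disjoint_cwEdges_hubPairsL H hPf hdp, disjoint_hubPairsL H htk hdp fun q hq hq' => ?_⟩
    exact List.disjoint_take_drop hnd le_rfl hq hq'
  rw [prodBernoulli_real_inter_of_determinedBy_disjoint w hd1 dD dVU (hmeas _) (hmeas _),
    prodBernoulli_real_inter_of_determinedBy_disjoint w hd2 dV dU (hmeas _) (hmeas _), mul_assoc]

include H hps hsort in
/-- **`P_w(arcCountL ps = 0) = omH |ps| C`**, `C = chainOf … 0 ps`. [this work] -/
theorem real_arcCountL_eq_zero :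
    (prodBernoulli w).real {ω | arcCountL L cyc S A ps ω = 0} = omH ps.length (chainOf L cyc S A w 0 ps) := by
  have hnd : ps.Nodup := hsort.imp ne_of_lt
  set C := chainOf L cyc S A w 0 ps with hC
  rw [real_eq_sum_Dext w hps hsort]
  -- each cell
  have cell : ∀ f ∈ Finset.range (ps.length + 1),
      (prodBernoulli w).real ({ω | arcCountL L cyc S A ps ω = 0} ∩ Dext L cyc ps f) =
        (prodBernoulli w).real (Dext L cyc ps f) * (1 - g1 f C) * ZQ ps.length f C := by
    intro f hf
    have hf' : f ≤ ps.length := by simpa [Nat.lt_succ_iff] using hf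
    have e : {ω | arcCountL L cyc S A ps ω = 0} ∩ Dext L cyc ps f =
        Dext L cyc ps f ∩ ({ω | ¬ 1 ≤ coll L cyc S A (ps.take f) ω} ∩ {ω | units cyc S A (ps.drop f) ω = 0}) := by
      ext ω
      simp only [Set.mem_inter_iff, mem_setOf_eq]
      constructor
      · rintro ⟨h0, hD⟩
        rw [arcCountL_eq_on_Dext A hps hsort hD] at h0
        exact ⟨hD, by omega, by omega⟩
      · rintro ⟨hD, h1, h2⟩
        rw [arcCountL_eq_on_Dext A hps hsort hD]
        exact ⟨by omega, hD⟩
    have hmeas : ∀ U : Set (BondConfig (Fin n)), MeasurableSet U := fun U => (Set.toFinite U).measurableSet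
    have hc : (prodBernoulli w).real {ω | ¬ 1 ≤ coll L cyc S A (ps.take f) ω} = 1 - g1 f C := by
      have : {ω : BondConfig (Fin n) | ¬ 1 ≤ coll L cyc S A (ps.take f) ω} = {ω | 1 ≤ coll L cyc S A (ps.take f) ω}ᶜ := rfl
      rw [this, probReal_compl_eq_one_sub (hmeas _), real_coll_ge_one H A w hps hsort 0 hf']
    rw [e, real_Dext_inter H A w hps hsort f (fun k => ¬ 1 ≤ k) (fun k => k = 0), hc, real_units_drop_eq_zero H A w hps hnd 0 f]
  rw [Finset.sum_congr rfl cell, Finset.sum_range_succ', real_Dext_zero H A w]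
  simp only [TwoChain.g1_zero, sub_zero, mul_one, TwoChain.ZQ_zero_right]
  have hterm : ∀ f ∈ Finset.range ps.length,
      (prodBernoulli w).real (Dext L cyc ps (f + 1)) * (1 - g1 (f + 1) C) * ZQ ps.length (f + 1) C =
        (C.B (f + 1 + 1) - C.B (f + 1)) * ZQ ps.length (f + 1) C - (C.B (f + 1 + 1) - C.B (f + 1)) * ZQ ps.length (f + 1) C * g1 (f + 1) C := by
    intro f _
    rw [real_Dext_succ H A w hps hsort f, ← hC]
    ring
  rw [Finset.sum_congr rfl hterm, Finset.sum_sub_distrib]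
  unfold TwoChain.omH TwoChain.PE TwoChain.DN TwoChain.w
  ring

include H hps hsort in
/-- **`P_w(arcCountL ps ≥ 2) = TT |ps| C`**, `C = chainOf … 0 ps`. [this work] -/
theorem real_arcCountL_ge_two :
    (prodBernoulli w).real {ω | 2 ≤ arcCountL L cyc S A ps ω} = TT ps.length (chainOf L cyc S A w 0 ps) := by
  have hmeas : ∀ U : Set (BondConfig (Fin n)), MeasurableSet U := fun U => (Set.toFinite U).measurableSet
  have hnd : ps.Nodup := hsort.imp ne_of_lt
  set C := chainOf L cyc S A w 0 ps with hC
  have hV : C.Valid ps.length := chainOf_valid w A hsort (fun p _ => Nat.zero_le p) (fun p hp => (hps p hp).2.le) (Nat.zero_le L)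
  rw [real_eq_sum_Dext w hps hsort]
  have cell : ∀ f ∈ Finset.range (ps.length + 1),
      (prodBernoulli w).real ({ω | 2 ≤ arcCountL L cyc S A ps ω} ∩ Dext L cyc ps f) =
        (prodBernoulli w).real (Dext L cyc ps f) *
          ((1 - ZQ ps.length f C - SQ ps.length f C) + g1 f C * SQ ps.length f C + g2 f C * ZQ ps.length f C) := by
    intro f hf
    have hf' : f ≤ ps.length := by simpa [Nat.lt_succ_iff] using hf
    set V := fun (P : ℕ → Prop) => {ω : BondConfig (Fin n) | P (coll L cyc S A (ps.take f) ω)} with hVdef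
    set U := fun (Q : ℕ → Prop) => {ω : BondConfig (Fin n) | Q (units cyc S A (ps.drop f) ω)} with hUdef
    have e : {ω | 2 ≤ arcCountL L cyc S A ps ω} ∩ Dext L cyc ps f =
        ((Dext L cyc ps f ∩ (V (fun _ => True) ∩ U (fun k => 2 ≤ k))) ∪ (Dext L cyc ps f ∩ (V (fun k => 1 ≤ k) ∩ U (fun k => k = 1)))) ∪
          (Dext L cyc ps f ∩ (V (fun k => 2 ≤ k) ∩ U (fun k => k = 0))) := by
      ext ω
      simp only [hVdef, hUdef, Set.mem_inter_iff, Set.mem_union, mem_setOf_eq, true_and]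
      constructor
      · rintro ⟨h2, hD⟩
        rw [arcCountL_eq_on_Dext A hps hsort hD] at h2
        by_cases hu2 : 2 ≤ units cyc S A (ps.drop f) ω
        · exact Or.inl (Or.inl ⟨hD, hu2⟩)
        · by_cases hu1 : units cyc S A (ps.drop f) ω = 1
          · exact Or.inl (Or.inr ⟨hD, by omega, hu1⟩)
          · exact Or.inr ⟨hD, by omega, by omega⟩
      · rintro ((⟨hD, h⟩ | ⟨hD, h1, h2⟩) | ⟨hD, h1, h2⟩) <;> refine ⟨?_, hD⟩ <;>
          rw [arcCountL_eq_on_Dext A hps hsort hD] <;> omega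
    have hdA : Disjoint (Dext L cyc ps f ∩ (V (fun _ => True) ∩ U (fun k => 2 ≤ k))) (Dext L cyc ps f ∩ (V (fun k => 1 ≤ k) ∩ U (fun k => k = 1))) := by
      rw [Set.disjoint_left]; rintro ω ⟨-, -, h⟩ ⟨-, -, h'⟩; simp only [hUdef, mem_setOf_eq] at h h'; omega
    have hdB : Disjoint ((Dext L cyc ps f ∩ (V (fun _ => True) ∩ U (fun k => 2 ≤ k))) ∪ (Dext L cyc ps f ∩ (V (fun k => 1 ≤ k) ∩ U (fun k => k = 1))))
        (Dext L cyc ps f ∩ (V (fun k => 2 ≤ k) ∩ U (fun k => k = 0))) := by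
      rw [Set.disjoint_left]; rintro ω (⟨-, -, h⟩ | ⟨-, -, h⟩) ⟨-, -, h'⟩ <;> simp only [hUdef, mem_setOf_eq] at h h' <;> omega
    rw [e, measureReal_union hdB (hmeas _), measureReal_union hdA (hmeas _)]
    simp only [hVdef, hUdef]
    rw [real_Dext_inter H A w hps hsort f (fun _ => True) (fun k => 2 ≤ k), real_Dext_inter H A w hps hsort f (fun k => 1 ≤ k) (fun k => k = 1),
      real_Dext_inter H A w hps hsort f (fun k => 2 ≤ k) (fun k => k = 0), real_units_ge_two A w, real_units_drop_eq_zero H A w hps hnd 0 f,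
      real_units_drop_eq_one H A w hps hnd 0 f, real_coll_ge_one H A w hps hsort 0 hf', real_coll_ge_two H A w hps hsort 0 hf']
    have : (prodBernoulli w).real {ω : BondConfig (Fin n) | True} = 1 := by
      rw [show {ω : BondConfig (Fin n) | True} = Set.univ from Set.setOf_true, probReal_univ]
    rw [this]; ring
  rw [Finset.sum_congr rfl cell, Finset.sum_range_succ', real_Dext_zero H A w]
  simp only [TwoChain.g1_zero, TwoChain.g2_zero, zero_mul, add_zero, TwoChain.ZQ_zero_right, TwoChain.SQ_zero_right]
  have hsw := TwoChain.sum_w hV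
  unfold TwoChain.w at hsw
  have split : ∀ f ∈ Finset.range ps.length,
      (prodBernoulli w).real (Dext L cyc ps (f + 1)) * ((1 - ZQ ps.length (f + 1) C - SQ ps.length (f + 1) C)
        + g1 (f + 1) C * SQ ps.length (f + 1) C + g2 (f + 1) C * ZQ ps.length (f + 1) C) =
      (C.B (f + 1 + 1) - C.B (f + 1)) - (C.B (f + 1 + 1) - C.B (f + 1)) * ZQ ps.length (f + 1) C
        - (C.B (f + 1 + 1) - C.B (f + 1)) * SQ ps.length (f + 1) C
        + (C.B (f + 1 + 1) - C.B (f + 1)) * SQ ps.length (f + 1) C * g1 (f + 1) C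
        + (C.B (f + 1 + 1) - C.B (f + 1)) * ZQ ps.length (f + 1) C * g2 (f + 1) C := by
    intro f _
    rw [real_Dext_succ H A w hps hsort f, ← hC]
    ring
  rw [Finset.sum_congr rfl split, Finset.sum_add_distrib, Finset.sum_add_distrib, Finset.sum_sub_distrib, Finset.sum_sub_distrib, hsw]
  unfold TwoChain.TT TwoChain.GZ TwoChain.GS TwoChain.PE TwoChain.PS TwoChain.w
  ring

end Laws

/-! ## The loaded positions -/

/-- Hub `j` is LOADED: it carries a relay (in `S j` or at the anchor). [this work] -/
def Loaded (cyc : ℕ → Fin n) (S : ℕ → Finset (Fin n)) (A : Finset (Fin n)) (j : ℕ) : Prop := (A ∩ S j).Nonempty ∨ cyc j ∈ A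

/-- The loaded positions `1 ≤ j < L` in increasing order. [this work] -/
def loadedList (L : ℕ) (cyc : ℕ → Fin n) (S : ℕ → Finset (Fin n)) (A : Finset (Fin n)) : List ℕ :=
  (List.range L).filter fun j => decide (1 ≤ j ∧ Loaded cyc S A j)

section Loaded

variable (L : ℕ) (cyc : ℕ → Fin n) (S : ℕ → Finset (Fin n)) (A : Finset (Fin n))

/-- Membership in the loaded list. [this work] -/
theorem mem_loadedList {j : ℕ} : j ∈ loadedList L cyc S A ↔ j < L ∧ 1 ≤ j ∧ Loaded cyc S A j := by
  simp [loadedList, List.mem_filter]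

/-- The loaded list is strictly increasing. [this work] -/
theorem loadedList_sorted : (loadedList L cyc S A).Pairwise (· < ·) := List.pairwise_lt_range.filter _

/-- Its entries lie in `[1, L)`. [this work] -/
theorem loadedList_bound : ∀ p ∈ loadedList L cyc S A, 1 ≤ p ∧ p < L :=
  fun _ hp => ⟨((mem_loadedList L cyc S A).1 hp).2.1, ((mem_loadedList L cyc S A).1 hp).1⟩

/-- An unloaded hub counts nothing. [this work] -/
theorem hubCount_eq_zero_of_not_loaded {j : ℕ} (hj : ¬ Loaded cyc S A j) (ω : BondConfig (Fin n)) : hubCount cyc S A j ω = 0 := by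
  rw [Loaded, not_or, Finset.not_nonempty_iff_eq_empty] at hj
  simp [hubCount, hj.1, hj.2]

/-- **The block's arc count is the arc count over the loaded positions.** [this work] -/
theorem arcCount_eq_arcCountL (ω : BondConfig (Fin n)) : arcCount L cyc S A ω = arcCountL L cyc S A (loadedList L cyc S A) ω := by
  unfold arcCount arcCountL
  have hnd : (loadedList L cyc S A).Nodup := (loadedList_sorted L cyc S A).imp ne_of_lt
  rw [← List.sum_toFinset _ hnd]
  symm
  apply Finset.sum_subset
  · intro j hj
    rw [List.mem_toFinset, mem_loadedList] at hj
    exact mem_cpos.2 ⟨hj.2.1, hj.1⟩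
  · intro j hj hjn
    rw [List.mem_toFinset, mem_loadedList] at hjn
    have hnl : ¬ Loaded cyc S A j := fun h => hjn ⟨(mem_cpos.1 hj).2, (mem_cpos.1 hj).1, h⟩
    simp [hubCount_eq_zero_of_not_loaded cyc S A hnl ω]

end Loaded

end Block

end Quant

end Summit.CriticalPhenomena.PercolationContinuityZ3.Theorems
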